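import Mathlib

/-!
# Wall bubbling for `DoorA26` — obligation (M): the FARKAS STEP of the second-order sieve (kernel, def-free) + one replayed leaf

LINE / STUB.  Crux `Theses.LacunarySymmetroid.DoorA26` (stmt-ValiantsHypothesis-19979; OPEN, typed, never asserted), line
`Cruxes/DoorA26/Lines/wall_bubbling.lean`, obligation **(M) `Stmt.stub_mixedWalls`**; the line's (M)-instrument (`Lines/wall_bubbling_M-sieve.md`):
every kill of the exact per-point sieve is a finite tree of INFEASIBLE rational LPs, each emitted with an integer FARKAS certificate (§2.8: LEAF
record = rows `ub` (`a·x ≤ b`), rows `eq` (`a·x = b`), unknowns `x ≥ 0` = heights against the plateau, multipliers `farkas_ub ≥ 0`, `farkas_eq`,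
with `Σλ·a ≥ 0` coefficientwise and `Σλ·b < 0`).  This file is soundness-ledger item (vi) in kernel form (line lead's W1 #8, l.11838):
* `farkas_step` — over any linear ordered field: multipliers `λ ≥ 0` (ub rows) and `μ` (eq rows) with non-negative combined coefficients and
  negative combined right-hand side REFUTE `{x ≥ 0 | A_ub x ≤ b_ub, A_eq x = b_eq}`;
* `farkas_step_strict` — the affine strict form: `y ≥ 0`, `y ≠ 0`, `yᵀA = 0`, `yᵀb ≤ 0` refute `{z | A z + b > 0}` (free coordinates);
* `leaf_mid_v0_L0_fin27_core67` — ONE logged leaf replayed VERBATIM as the template for kernel replay: the LEAF record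
  `{"case": "L0 fin[2,7] core[6,7]", "assign": [["R2130.C2130", 2]], "ub": [...7 rows...], "eq": [[{3:1, 5:−1}, −1]], "farkas_ub": [3,1,0,0,0,0,8],
  "farkas_eq": [8]}` of the checker-verified stream `pub/ideators/val-idea-15/lines/g2/certs/cert_mid_v0.jsonl.gz` (middle wall `13|22`,
  δ* = (0,1/10,1/4,2/5,18/25,1), variant v0; the `r103d` stream named by the line lead is not deposited under `certs/`, so the deposited
  `mid v0` run is used) — variables indexed `0..5` as in the record (indices `0,1` unused).  The 10⁴-leaf replays are NOT a W-file (line lead).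
HONEST FRAMING.  Cell `pub-symmetroid`, seat val-sym-door-p2 g11 (re-pointed W1, R2664), `--supports stmt-ValiantsHypothesis-19979 --as helper`.
Linear algebra over ordered fields; no new definitions; what the rows MEAN (ledger items (i)–(v)) is not asserted here; (M), (W), (R), `DoorA26` OPEN;
nothing on `MatrixDescartes` (stmt-18050) or `VP ≠ VNP`. [folklore: Farkas' lemma, easy direction]
-/

-- `Summit.ValiantsHypothesis.ValiantsHypothesis.…` repeats a component by the D-0017 layout
-- (single-conjunct summit), which the `dupNamespace` linter flags; the name is mandated.
set_option linter.dupNamespace false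

namespace Summit.ValiantsHypothesis.ValiantsHypothesis.Theorems.LacunarySymmetroidMatrixDescartes.WallBubbling

open Finset
open scoped BigOperators

/-- **FARKAS STEP (LP form of the sieve's leaves).**  If `λ ≥ 0` on the `≤`-rows and arbitrary `μ` on the `=`-rows give non-negative combined
coefficients `∑ᵢ λᵢ Aubᵢⱼ + ∑ᵢ μᵢ Aeqᵢⱼ ≥ 0` for every unknown `j` and a negative combined right-hand side, then no `x ≥ 0` satisfies
`Aub x ≤ bub ∧ Aeq x = beq`. [folklore] -/
theorem farkas_step {K : Type*} [Field K] [LinearOrder K] [IsStrictOrderedRing K] {m k n : ℕ}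
    (Aub : Fin m → Fin n → K) (bub : Fin m → K) (Aeq : Fin k → Fin n → K) (beq : Fin k → K)
    (lam : Fin m → K) (mu : Fin k → K) (hlam : ∀ i, 0 ≤ lam i)
    (hcoef : ∀ j, 0 ≤ (∑ i, lam i * Aub i j) + ∑ i, mu i * Aeq i j)
    (hrhs : (∑ i, lam i * bub i) + ∑ i, mu i * beq i < 0) :
    ¬ ∃ x : Fin n → K, (∀ j, 0 ≤ x j) ∧ (∀ i, ∑ j, Aub i j * x j ≤ bub i) ∧ (∀ i, ∑ j, Aeq i j * x j = beq i) := by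
  rintro ⟨x, hx, hub, heq⟩
  -- 0 ≤ ∑_j (combined coefficient j) · x_j = ∑_i λ_i (Aub_i · x) + ∑_i μ_i (Aeq_i · x) ≤ ∑ λ b + ∑ μ beq < 0
  have h0 : 0 ≤ ∑ j, ((∑ i, lam i * Aub i j) + ∑ i, mu i * Aeq i j) * x j :=
    Finset.sum_nonneg fun j _ => mul_nonneg (hcoef j) (hx j)
  have hswap : ∑ j, ((∑ i, lam i * Aub i j) + ∑ i, mu i * Aeq i j) * x j =
      (∑ i, lam i * ∑ j, Aub i j * x j) + ∑ i, mu i * ∑ j, Aeq i j * x j := by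
    simp only [add_mul, Finset.sum_add_distrib, Finset.sum_mul, Finset.mul_sum]
    rw [Finset.sum_comm (f := fun j i => lam i * Aub i j * x j), Finset.sum_comm (f := fun j i => mu i * Aeq i j * x j)]
    congr 1 <;> refine Finset.sum_congr rfl fun i _ => Finset.sum_congr rfl fun j _ => by ring
  rw [hswap] at h0
  have h1 : (∑ i, lam i * ∑ j, Aub i j * x j) ≤ ∑ i, lam i * bub i :=
    Finset.sum_le_sum fun i _ => mul_le_mul_of_nonneg_left (hub i) (hlam i)
  have h2 : (∑ i, mu i * ∑ j, Aeq i j * x j) = ∑ i, mu i * beq i :=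
    Finset.sum_congr rfl fun i _ => by rw [heq i]
  rw [h2] at h0
  linarith

/-- **FARKAS STEP, affine strict form** (the line lead's phrasing: free coordinates `z`, system `A z + b > 0` componentwise): `y ≥ 0`, `y ≠ 0`,
`yᵀ A = 0`, `yᵀ b ≤ 0` refute it. [folklore] -/
theorem farkas_step_strict {K : Type*} [Field K] [LinearOrder K] [IsStrictOrderedRing K] {m n : ℕ}
    (A : Fin m → Fin n → K) (b : Fin m → K) (y : Fin m → K) (hy : ∀ i, 0 ≤ y i) (hy0 : ∃ i, 0 < y i)
    (hA : ∀ j, ∑ i, y i * A i j = 0) (hb : ∑ i, y i * b i ≤ 0) :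
    ¬ ∃ z : Fin n → K, ∀ i, 0 < (∑ j, A i j * z j) + b i := by
  rintro ⟨z, hz⟩
  obtain ⟨i₀, hi₀⟩ := hy0
  -- ∑ y_i (A_i z + b_i) > 0 but equals (yᵀA) z + yᵀ b = yᵀ b ≤ 0
  have hpos : 0 < ∑ i, y i * ((∑ j, A i j * z j) + b i) := by
    have hle : ∀ i ∈ (Finset.univ : Finset (Fin m)), 0 ≤ y i * ((∑ j, A i j * z j) + b i) :=
      fun i _ => mul_nonneg (hy i) (hz i).le
    have hlt : 0 < y i₀ * ((∑ j, A i₀ j * z j) + b i₀) := mul_pos hi₀ (hz i₀)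
    exact lt_of_lt_of_le hlt (Finset.single_le_sum hle (Finset.mem_univ i₀))
  have hsum : ∑ i, y i * ((∑ j, A i j * z j) + b i) = (∑ j, (∑ i, y i * A i j) * z j) + ∑ i, y i * b i := by
    simp only [mul_add, Finset.sum_add_distrib, Finset.mul_sum, Finset.sum_mul]
    rw [Finset.sum_comm (f := fun i j => y i * (A i j * z j))]
    congr 1
    refine Finset.sum_congr rfl fun j _ => Finset.sum_congr rfl fun i _ => by ring
  rw [hsum] at hpos
  have hzero : ∑ j, (∑ i, y i * A i j) * z j = 0 := Finset.sum_eq_zero fun j _ => by rw [hA j, zero_mul]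
  rw [hzero, zero_add] at hpos
  linarith

/-! ## One replayed leaf (template) -/

/-- **Replay of the LEAF `L0 fin[2,7] core[6,7]` / assign `[["R2130.C2130", 2]]` of `cert_mid_v0.jsonl.gz`** (val-idea-15 g2's checker-verified
certificate stream for the middle wall `13|22` at δ* = (0,1/10,1/4,2/5,18/25,1), variant v0).  Unknowns `x₀ … x₅ ≥ 0` (indices as logged; `x₀, x₁`
do not occur); seven `≤`-rows and one `=`-row, sparse as logged:
`−2x₂+3x₃−x₄ ≤ 0`, `−x₃+3x₄−2x₅ ≤ 0`, `−2x₄+3x₅ ≤ 0`, `−x₅ ≤ 0`, `x₂−2x₄ ≤ 1`, `x₂−x₃−x₄+x₅ ≤ 0`, `x₂−2x₃+2x₅ ≤ −1`, `x₃−x₅ = −1`;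
multipliers `farkas_ub = [3,1,0,0,0,0,8]`, `farkas_eq = [8]` (combined coefficients `(0,0,2,0,0,6) ≥ 0`, right-hand side `−16 < 0`). [this work] -/
theorem leaf_mid_v0_L0_fin27_core67 :
    ¬ ∃ x : Fin 6 → ℚ, (∀ j, 0 ≤ x j) ∧
      (∀ i, ∑ j, (![![0, 0, -2, 3, -1, 0], ![0, 0, 0, -1, 3, -2], ![0, 0, 0, 0, -2, 3], ![0, 0, 0, 0, 0, -1],
                   ![0, 0, 1, 0, -2, 0], ![0, 0, 1, -1, -1, 1], ![0, 0, 1, -2, 0, 2]] : Fin 7 → Fin 6 → ℚ) i j * x j ≤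
        (![0, 0, 0, 0, 1, 0, -1] : Fin 7 → ℚ) i) ∧
      (∀ i, ∑ j, (![![0, 0, 0, 1, 0, -1]] : Fin 1 → Fin 6 → ℚ) i j * x j = (![-1] : Fin 1 → ℚ) i) :=
  farkas_step _ _ _ _ ![3, 1, 0, 0, 0, 0, 8] ![8]
    (by intro i; fin_cases i <;> norm_num)
    (by intro j; fin_cases j <;> norm_num [Fin.sum_univ_succ])
    (by norm_num [Fin.sum_univ_succ])

end Summit.ValiantsHypothesis.ValiantsHypothesis.Theorems.LacunarySymmetroidMatrixDescartes.WallBubbling
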